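/-
COR-CM (cell pub-hodgecm2) — RSCONJ row Ω (A7, the ω-LABEL face of the μ ↦ μᶜ identification), ROUTE C
(`HOME/d2bridge/ident/ident-1/omega/OMEGA-ROUTE-C.md`): the θ-TWIST `g ↦ ḡ` of the unitary dual-pair Weil carriers is
TRANSPORT OF STRUCTURE along the anti-symplectic involution `Λ : (x, y) ↦ (x, −y)` of `𝕎_𝔸 = 𝔸ⁿ × 𝔸ⁿ`, which the tree
already implements as the relabelling `adelicMpContRelabel (C := −1)` (✔ `Weil1964/AdelicMetaplecticTransport`).
Seat prover-pub-hodgeaudit-ident-1-g3-0 (ident-1 GEN 3), checker ident-2, 2026-08-24.  PART II OF 3 (RecordSystemConjOmegaTwistCompatible).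
KERNEL ONLY: definitions by explicit formula + theorems; no named fact, no instance, no `sorry`.  HC_CM is NOT proved;
HELD — WORLD = C FINAL; nothing displayed by an END is discharged here.
-/
import Summits.HodgeConjecture.CorCM.B01.Transposition.HComp.RecordSystemConjOmegaTwist
import HarnessLib

set_option autoImplicit false

/-!
# The θ-twist of the unitary dual-pair Weil carriers, II: `Λ ι_{−a}(ḡ) Λ⁻¹ = ι_a(g)` and the COMPATIBLE transported family

Sequel of `RecordSystemConjOmegaTwist` (Part I: `relabelNeg`, `pairConj`, the rational lifts).

* §1 (K-b) **`symplecticGroupCongr_toSp_pairConjNeg`**: for the restriction-of-scalars embeddings `ι_{±a} : G₁(𝔸) → Sp(W_{𝕋_{±a}})`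
  of the pair groups at the lines `⟨±a⟩`, `Λ ι_{−a}(ḡ) Λ⁻¹ = ι_a(g)` — because `reIm (c̄ ∘ x) = Λ (reIm x)` in the coordinates
  `x + δ y ↦ (x, y)` (✔ `re_conj ∕ im_conj ∕ toSymplectic_reIm`); `pairConjNeg a : U(J_V ⊗ J_W(a))(𝔸) →* U(J_V ⊗ J_W(−a))(𝔸)`.
* §2 (K-c) the TRANSPORTED FAMILY **`conjFamily s a := relabelNeg a ∘ s (−a) ∘ pairConjNeg a`** of a family `s` of splittings at
  the lines, `omega_conjFamily` (`ω ∘ s′_a = ω ∘ s_{−a} ∘ (ḡ)` ON THE NOSE), `pairConjNeg_mem_range_rational`, and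
  **`isCompatible_conjFamily`**: if every `s a` is [GelbartRogawski1991, Prop. 3.1.1]-compatible then so is every `conjFamily s a`
  (over `ι_a` by (K-b) + `proj_relabelNeg`; rational values by (R1)).

Part III (`…OmegaTwistCarriers`): the carriers `ω(s′_a; a; χ) ≅ ω(s_{−a}; −a; χ⁻¹) ∘ (k ↦ k̄)`.

References: [GelbartRogawski1991] §3.1 p. 454–457; [Weil1964] Chap. I n° 4–5, Chap. III n° 37–41; [MoeglinVignerasWaldspurger1987]
Chap. 2 II.1; [Kudla1996] V.3 (`W⁻`, `Sp(W) = Sp(W⁻)`); [PlatonovRapinchuk1994] §5.1; [Liu2021] Def. 4.11–4.12, Rem. 4.4, App. D §D.1.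
-/

noncomputable section

open scoped Matrix Kronecker
open NumberField IsDedekindDomain
open Literature.RepresentationTheory.HeisenbergGroup
open Literature.NumberTheory.Automorphic Literature.NumberTheory.Automorphic.UnitaryGroup
open Literature.NumberTheory.Weil1964
open Literature.NumberTheory.GelbartRogawski1991 Literature.NumberTheory.GelbartRogawski1991.UnitaryDualPair
open Literature.NumberTheory.GelbartRogawski1991.UnitaryDualPair.WeilCoinv
open Literature.RepresentationTheory
open Literature.NumberTheory.Automorphic.Liu2021.Def411WeilCarriers (TW JW JW_eq isSymm_TW isUnit_det_TW Chi lineChar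
  lineChar_finAdelicCenter lineCenterEquiv lineCenterEquiv_apply IsAutomorphicOneChar omegaAtLine rhoVAtLine)

namespace Summit.HodgeConjecture.CorCM.HComp.OmegaConj

/-! ## §1 (K-b) The symplectic embeddings at `±a` under conjugation: `ι_a(g) = Λ ι_{−a}(ḡ) Λ⁻¹` -/

section Symplectic

variable (F E : Type) [Field F] [NumberField F] [Field E] [NumberField E] [Algebra F E]
variable (c : E ≃ₐ[F] E) (N : ℕ) {n : ℕ} (e : Fin N × Fin 1 ≃ Fin n)
variable (JV : Matrix (Fin N) (Fin N) E) {TV : Matrix (Fin N) (Fin N) F}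
variable [Algebra.IsQuadraticExtension F E] {δ : E} (hcδ : c δ = -δ) (hδ : δ ≠ 0) {d : F}
  (hd : δ * δ = algebraMap F E d) (hV : TV.IsSymm) (hVd : IsUnit TV.det) (hJV : JV = TV.map (algebraMap F E))

omit [NumberField F] [NumberField E] [Algebra.IsQuadraticExtension F E] in
/-- `J_W(−a) = −J_W(a)`. [cite: Liu2021, App. D §D.1 Step 1 (l. 5215)] -/
theorem JW_neg (a : Fˣ) : JW F E (-a) = -JW F E a := by
  rw [JW, JW, TW_neg, Matrix.map_neg _ (map_neg (algebraMap F E))]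

omit [NumberField F] [Algebra.IsQuadraticExtension F E] in
/-- the big pair groups at `±a` COINCIDE: `U(J_V ⊗ J_W(−a))(𝔸) = U(J_V ⊗ J_W(a))(𝔸)`. [cite: Kudla1996, V.3] -/
theorem adelicPair_line_neg (a : Fˣ) : adelicPair F E c N 1 JV (JW F E (-a)) = adelicPair F E c N 1 JV (JW F E a) := by
  rw [JW_neg, adelicPair_neg]

/-- **`g ↦ ḡ` from the pair group at `a` to the pair group at `−a`**: entrywise `c ⊗ 1` followed by the identification
`U(J_V ⊗ J_W(a)) = U(J_V ⊗ J_W(−a))`. [cite: PlatonovRapinchuk1994, §5.1] [cite: Kudla1996, V.3] -/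
def pairConjNeg (a : Fˣ) : adelicPair F E c N 1 JV (JW F E a) →* adelicPair F E c N 1 JV (JW F E (-a)) :=
  (MulEquiv.subgroupCongr (adelicPair_line_neg F E c N JV a).symm).toMonoidHom.comp
    (pairConj F E c N 1 hJV (JW_eq F E a))

omit [NumberField F] [Algebra.IsQuadraticExtension F E] in
/-- underlying matrix of `pairConjNeg a g`: `GL(c ⊗ 1) g`. [folklore] -/
@[simp] theorem coe_pairConjNeg (a : Fˣ) (g : adelicPair F E c N 1 JV (JW F E a)) :
    ((pairConjNeg F E c N JV hJV a g : adelicPair F E c N 1 JV (JW F E (-a))) : GL (Fin N × Fin 1) (AdeleRing (𝓞 E) E)) =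
      Matrix.GeneralLinearGroup.map (conjAdele F E c) g := rfl

/-- **`reIm (c̄ ∘ x) = Λ (reIm x)`**: in the coordinates `x + δ y ↦ (x, y)` of `𝔸_E^m`, entrywise conjugation is
`(x, y) ↦ (x, −y)` (✔ `re_conj`, `im_conj`), and `reindex` commutes with it. [cite: Weil1964, Chap. I n° 4 p. 149] -/
theorem relabelVec_neg_one_reindexW_reIm (hd : δ * δ = algebraMap F E d) (x : Fin N × Fin 1 → AdeleRing (𝓞 E) E) :
    relabelVec F (Fin n) (-1) (reindexW (AdeleRing (𝓞 F) F) e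
        (QuadraticCoordinates.reIm (quadraticAdeleEquiv F E c hcδ hδ).toAddEquiv (Fin N × Fin 1) x)) =
      reindexW (AdeleRing (𝓞 F) F) e
        (QuadraticCoordinates.reIm (quadraticAdeleEquiv F E c hcδ hδ).toAddEquiv (Fin N × Fin 1)
          (conjAdele F E c ∘ x)) := by
  have h := isQuadraticCoordinates_adele E c hcδ hδ hd
  have hσφ : ∀ t, conjAdele F E c (AdeleRing.baseChange F E t) = AdeleRing.baseChange F E t := fun t => by
    rw [conjAdele_apply, AdeleRing.smul_baseChange]
  have hσδ : conjAdele F E c (algebraMap E (AdeleRing (𝓞 E) E) δ) = -algebraMap E (AdeleRing (𝓞 E) E) δ := by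
    rw [← algebraMap_conj, RingHom.coe_coe, hcδ, map_neg]
  refine Prod.ext ?_ ?_
  · ext i
    simp only [relabelVec_apply, reindexW_apply, Function.comp_apply, QuadraticCoordinates.reIm_apply_fst,
      h.re_conj hσφ hσδ]
  · ext i
    simp only [relabelVec_apply, reindexW_apply, Units.val_neg, Units.val_one, Matrix.neg_mulVec, Matrix.one_mulVec,
      Pi.neg_apply, Function.comp_apply, QuadraticCoordinates.reIm_apply_snd, h.im_conj hσφ hσδ]

omit [NumberField F] [Algebra.IsQuadraticExtension F E] in
/-- `c̄ ∘ c̄ = id` on vectors (`c² = 1`). [folklore] -/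
theorem conjAdele_comp_conjAdele_comp (hc : c * c = 1) (x : Fin N × Fin 1 → AdeleRing (𝓞 E) E) :
    conjAdele F E c ∘ (conjAdele F E c ∘ x) = x :=
  funext fun i => by
    simp only [Function.comp_apply, conjAdele_apply, smul_smul, hc, one_smul]

omit [NumberField F] [Algebra.IsQuadraticExtension F E] in
/-- `ḡ x̄ = c̄ (g x)` (a ring homomorphism commutes with `mulVec`). [folklore] -/
theorem map_conjAdele_mulVec_conj (g : Matrix (Fin N × Fin 1) (Fin N × Fin 1) (AdeleRing (𝓞 E) E))
    (x : Fin N × Fin 1 → AdeleRing (𝓞 E) E) :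
    g.map (conjAdele F E c) *ᵥ (conjAdele F E c ∘ x) = conjAdele F E c ∘ (g *ᵥ x) := by
  funext i
  exact (RingHom.map_mulVec (conjAdele F E c) g x i).symm

/-- `ι(g) (reIm x) = reIm (g x)` for the pair embedding of record (✔ `toSymplectic_reIm`, restated for `rw`). [folklore] -/
theorem adelicPairToSymplectic_reIm {M : ℕ} {TW : Matrix (Fin M) (Fin M) F} {JW : Matrix (Fin M) (Fin M) E}
    (hW : TW.IsSymm) (hJW : JW = TW.map (algebraMap F E)) (g : adelicPair F E c N M JV JW)
    (x : Fin N × Fin M → AdeleRing (𝓞 E) E) :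
    (adelicPairToSymplectic F E c N M hcδ hδ hd hV hW hJV hJW g).1
        (QuadraticCoordinates.reIm (quadraticAdeleEquiv F E c hcδ hδ).toAddEquiv (Fin N × Fin M) x) =
      QuadraticCoordinates.reIm (quadraticAdeleEquiv F E c hcδ hδ).toAddEquiv (Fin N × Fin M)
        ((g : GL (Fin N × Fin M) (AdeleRing (𝓞 E) E)).1 *ᵥ x) :=
  (isQuadraticCoordinates_adele E c hcδ hδ hd).toSymplectic_reIm (Fin N × Fin M)
    (isSymm_kronecker (hV.map _) (hW.map _)) (fun a => by rw [conjAdele_apply, AdeleRing.smul_baseChange])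
    (by rw [← algebraMap_conj, RingHom.coe_coe, hcδ, map_neg])
    (by rw [adelicForm_eq_map_map E N TV hJV, adelicForm_eq_map_map E M TW hJW, kronecker_map_map]) g x

/-- `ι_a(g)` on the vector `reindex_e (reIm x)`: `reindex_e (reIm (g x))`. [folklore] -/
theorem toSp_apply_reindexW_reIm {TW : Matrix (Fin 1) (Fin 1) F} {JW : Matrix (Fin 1) (Fin 1) E} (hW : TW.IsSymm)
    (hJW : JW = TW.map (algebraMap F E)) (g : adelicPair F E c N 1 JV JW) (x : Fin N × Fin 1 → AdeleRing (𝓞 E) E) :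
    ((toSp F E c N 1 e JV JW hcδ hδ hd hV hW hJV hJW g : symplecticGroup (polar (adelicForm F (Fin n) (adelicGram F e TV TW)))) :
        ((Fin n → AdeleRing (𝓞 F) F) × (Fin n → AdeleRing (𝓞 F) F)) ≃ₗ[AdeleRing (𝓞 F) F]
          ((Fin n → AdeleRing (𝓞 F) F) × (Fin n → AdeleRing (𝓞 F) F)))
        (reindexW (AdeleRing (𝓞 F) F) e (QuadraticCoordinates.reIm (quadraticAdeleEquiv F E c hcδ hδ).toAddEquiv (Fin N × Fin 1) x)) =
      reindexW (AdeleRing (𝓞 F) F) e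
        (QuadraticCoordinates.reIm (quadraticAdeleEquiv F E c hcδ hδ).toAddEquiv (Fin N × Fin 1)
          ((g : GL (Fin N × Fin 1) (AdeleRing (𝓞 E) E)).1 *ᵥ x)) := by
  rw [toSp_apply, coe_spReindex_apply, LinearEquiv.symm_apply_apply, adelicPairToSymplectic_reIm]

/-- **(K-b) `Λ ι_{−a}(ḡ) Λ⁻¹ = ι_a(g)`**: the restriction-of-scalars embedding of the pair group at the line `⟨a⟩` is the
`Λ`-conjugate of the embedding at `⟨−a⟩` precomposed with `g ↦ ḡ` — `Λ = (x, y) ↦ (x, −y)` being an isometry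
`(𝕎, β_{𝕋_{−a}}) ≃ (𝕎, β_{𝕋_a})`. [cite: Kudla1996, V.3] [cite: MoeglinVignerasWaldspurger1987, Chap. 2 II.1] -/
theorem symplecticGroupCongr_toSp_pairConjNeg (hc : c * c = 1) (a : Fˣ) (g : adelicPair F E c N 1 JV (JW F E a)) :
    symplecticGroupCongr (polar (adelicForm F (Fin n) (adelicGram F e TV (TW F (-a)))))
        (polar (adelicForm F (Fin n) (adelicGram F e TV (TW F a)))) (relabelVec F (Fin n) (-1))
        (polar_relabelVec F (Fin n) (-1) (adelicGram_mul_neg_one F e TV a))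
        (toSp F E c N 1 e JV (JW F E (-a)) hcδ hδ hd hV (isSymm_TW F (-a)) hJV (JW_eq F E (-a))
          (pairConjNeg F E c N JV hJV a g)) =
      toSp F E c N 1 e JV (JW F E a) hcδ hδ hd hV (isSymm_TW F a) hJV (JW_eq F E a) g := by
  refine Subtype.ext (LinearEquiv.ext fun w => ?_)
  -- every vector of `𝕎_𝔸` is `reindex_e (reIm x)`
  obtain ⟨x, rfl⟩ : ∃ x : Fin N × Fin 1 → AdeleRing (𝓞 E) E,
      reindexW (AdeleRing (𝓞 F) F) e
        (QuadraticCoordinates.reIm (quadraticAdeleEquiv F E c hcδ hδ).toAddEquiv (Fin N × Fin 1) x) = w :=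
    ⟨(QuadraticCoordinates.reIm (quadraticAdeleEquiv F E c hcδ hδ).toAddEquiv (Fin N × Fin 1)).symm
        ((reindexW (AdeleRing (𝓞 F) F) e).symm w), by rw [AddEquiv.apply_symm_apply, LinearEquiv.apply_symm_apply]⟩
  have hmat : ((pairConjNeg F E c N JV hJV a g : adelicPair F E c N 1 JV (JW F E (-a))) :
      GL (Fin N × Fin 1) (AdeleRing (𝓞 E) E)).1 = g.1.1.map (conjAdele F E c) := rfl
  rw [coe_symplecticGroupCongr_apply, relabelVec_neg_one_symm_apply,
    relabelVec_neg_one_reindexW_reIm F E c N e hcδ hδ hd, toSp_apply_reindexW_reIm, toSp_apply_reindexW_reIm, hmat,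
    map_conjAdele_mulVec_conj F E c N, relabelVec_neg_one_reindexW_reIm F E c N e hcδ hδ hd,
    conjAdele_comp_conjAdele_comp F E c N hc]

end Symplectic

/-! ## §2 (K-c) The transported family `conjFamily s a := R_a ∘ s(−a) ∘ (g ↦ ḡ)` is compatible -/

section Compatible

variable (F E : Type) [Field F] [NumberField F] [Field E] [NumberField E] [Algebra F E]
variable (c : E ≃ₐ[F] E) (N : ℕ) {n : ℕ} (e : Fin N × Fin 1 ≃ Fin n)
variable (JV : Matrix (Fin N) (Fin N) E) {TV : Matrix (Fin N) (Fin N) F}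
variable [Algebra.IsQuadraticExtension F E] {δ : E} (hcδ : c δ = -δ) (hδ : δ ≠ 0) {d : F}
  (hd : δ * δ = algebraMap F E d) (hV : TV.IsSymm) (hVd : IsUnit TV.det) (hJV : JV = TV.map (algebraMap F E))
variable (s : ∀ a : Fˣ, adelicPair F E c N 1 JV (JW F E a) →* adelicMpCont F (Fin n) (adelicGram F e TV (TW F a)))

/-- **THE TRANSPORTED FAMILY `s′_a := R_a ∘ s_{−a} ∘ (g ↦ ḡ)`**: the splitting of the pair `(J_V, ⟨a⟩)` obtained from the
splitting of `(J_V, ⟨−a⟩)` by entrywise conjugation of the group and the relabelling `Λ` of the metaplectic group.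
[cite: MoeglinVignerasWaldspurger1987, Chap. 2 II.1] [cite: GelbartRogawski1991, §3.1 Prop. 3.1.1 p. 455 L1–3] -/
def conjFamily (a : Fˣ) : adelicPair F E c N 1 JV (JW F E a) →* adelicMpCont F (Fin n) (adelicGram F e TV (TW F a)) :=
  ((relabelNeg F e TV a).toMonoidHom.comp (s (-a))).comp (pairConjNeg F E c N JV hJV a)

omit [Algebra.IsQuadraticExtension F E] in
/-- formula. [folklore] -/
theorem conjFamily_apply (a : Fˣ) (g : adelicPair F E c N 1 JV (JW F E a)) :
    conjFamily F E c N e JV hJV s a g = relabelNeg F e TV a (s (-a) (pairConjNeg F E c N JV hJV a g)) := rfl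

omit [Algebra.IsQuadraticExtension F E] in
/-- **the Weil operators of `s′_a` ARE those of `s_{−a} ∘ (g ↦ ḡ)`** (the relabelling does not move operators,
✔ `adelicMpCont.omega_relabel`). [cite: MoeglinVignerasWaldspurger1987, Chap. 2 II.1] -/
theorem omega_conjFamily (a : Fˣ) (g : adelicPair F E c N 1 JV (JW F E a)) :
    adelicMpCont.omega F (Fin n) (adelicGram F e TV (TW F a)) (conjFamily F E c N e JV hJV s a g) =
      adelicMpCont.omega F (Fin n) (adelicGram F e TV (TW F (-a))) (s (-a) (pairConjNeg F E c N JV hJV a g)) :=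
  omega_relabelNeg F e a _

omit [NumberField F] [Algebra.IsQuadraticExtension F E] in
/-- `(c ⊗ 1)(γ ⊗ 1) = (c γ) ⊗ 1` on `GL` (entrywise ✔ `algebraMap_conj`). [folklore] -/
theorem map_conjAdele_map_algebraMap {m : Type*} [Fintype m] [DecidableEq m] (γ : GL m E) :
    Matrix.GeneralLinearGroup.map (conjAdele F E c) (Matrix.GeneralLinearGroup.map (algebraMap E (AdeleRing (𝓞 E) E)) γ) =
      Matrix.GeneralLinearGroup.map (algebraMap E (AdeleRing (𝓞 E) E)) (Matrix.GeneralLinearGroup.map (c : E →+* E) γ) := by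
  refine Units.ext (Matrix.ext fun i j => ?_)
  exact (algebraMap_conj F E c _).symm

omit [NumberField F] [NumberField E] [Algebra.IsQuadraticExtension F E] in
/-- the RATIONAL pair form `J_V ⊗ J_W(a)` is fixed by `c` entrywise. [folklore] -/
theorem rationalForm_map_galConj (hJV : JV = TV.map (algebraMap F E)) (a : Fˣ) : (JV ⊗ₖ JW F E a).map (c : E →+* E) = JV ⊗ₖ JW F E a := by
  rw [← kronecker_map_map, hJV, JW, Matrix.map_map, Matrix.map_map]
  congr 1 <;> [skip; skip] <;>
  · congr 1
    funext t
    simp only [Function.comp_apply, RingHom.coe_coe, AlgEquiv.commutes]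

omit [NumberField F] [NumberField E] [Algebra.IsQuadraticExtension F E] in
/-- the rational pair groups at `±a` coincide. [cite: Kudla1996, V.3] -/
theorem rationalPair_line_neg (a : Fˣ) : rationalPair F E c N 1 JV (JW F E (-a)) = rationalPair F E c N 1 JV (JW F E a) := by
  rw [rationalPair, rationalPair, JW_neg, kronecker_neg_right, unitaryGroupOfForm_neg]

omit [NumberField F] [Algebra.IsQuadraticExtension F E] in
/-- **`g ↦ ḡ` preserves the rational points of the pair group**: `ψ(γ ⊗ 1) = (c γ) ⊗ 1` with `c γ ∈ G₁(F)`.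
[cite: PlatonovRapinchuk1994, §5.1] -/
theorem pairConjNeg_mem_range_rational (a : Fˣ) {γ : adelicPair F E c N 1 JV (JW F E a)}
    (hγ : γ ∈ (rationalPairToAdelic F E c N 1 JV (JW F E a)).range) :
    pairConjNeg F E c N JV hJV a γ ∈ (rationalPairToAdelic F E c N 1 JV (JW F E (-a))).range := by
  obtain ⟨γ₀, rfl⟩ := hγ
  have hmem : Matrix.GeneralLinearGroup.map (c : E →+* E) γ₀.1 ∈ rationalPair F E c N 1 JV (JW F E (-a)) := by
    have h := map_mem_unitaryGroupOfForm (c : E →+* E) (τ := (c : E →+* E)) (fun _ => rfl) γ₀.2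
    rw [rationalForm_map_galConj F E c N JV hJV a] at h
    rwa [rationalPair_line_neg]
  refine ⟨⟨_, hmem⟩, Subtype.ext ?_⟩
  rw [coe_pairConjNeg]
  exact (map_conjAdele_map_algebraMap F E c γ₀.1).symm

set_option maxHeartbeats 800000 in
-- (same `isDefEq` cost as above for the `ratPts` clause)
/-- **(K-c) THE TRANSPORTED FAMILY IS COMPATIBLE**: `s′_a` lies over `ι_a` ((K-b) + ✔ `proj_relabel`) and carries `G₁(F)`
into Weil's rational section `i_a(Sp_F)` ((R1) + rationality of `g ↦ ḡ`) — so `s′` is a legitimate family of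
[GelbartRogawski1991, Prop. 3.1.1]-compatible splittings at the lines `⟨a⟩`, built from `s` at the lines `⟨−a⟩`.
[cite: GelbartRogawski1991, §3.1 Prop. 3.1.1 p. 455 L1–3, Remark p. 457 L4] -/
theorem isCompatible_conjFamily (hc : c * c = 1)
    (hs : ∀ a : Fˣ, (splittingDatum F E c N 1 e JV (JW F E a) hcδ hδ hd hV (isSymm_TW F a) hVd (isUnit_det_TW F a) hJV
      (JW_eq F E a)).IsCompatible (s a)) (a : Fˣ) :
    (splittingDatum F E c N 1 e JV (JW F E a) hcδ hδ hd hV (isSymm_TW F a) hVd (isUnit_det_TW F a) hJV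
      (JW_eq F E a)).IsCompatible (conjFamily F E c N e JV hJV s a) := by
  refine ⟨fun g => ?_, fun γ hγ => ?_⟩
  · -- the `proj` clause: `π(s′_a g) = Λ π(s_{−a} ḡ) Λ⁻¹ = Λ ι_{−a}(ḡ) Λ⁻¹ = ι_a(g)`
    have h1 : adelicMpCont.proj F (Fin n) (adelicGram F e TV (TW F (-a))) (s (-a) (pairConjNeg F E c N JV hJV a g)) =
        toSp F E c N 1 e JV (JW F E (-a)) hcδ hδ hd hV (isSymm_TW F (-a)) hJV (JW_eq F E (-a))
          (pairConjNeg F E c N JV hJV a g) :=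
      (hs (-a)).1 (pairConjNeg F E c N JV hJV a g)
    change adelicMpCont.proj F (Fin n) (adelicGram F e TV (TW F a)) (conjFamily F E c N e JV hJV s a g) =
      toSp F E c N 1 e JV (JW F E a) hcδ hδ hd hV (isSymm_TW F a) hJV (JW_eq F E a) g
    rw [conjFamily_apply, proj_relabelNeg, h1]
    exact symplecticGroupCongr_toSp_pairConjNeg F E c N e JV hcδ hδ hd hV hJV hc a g
  · -- the `ratPts` clause: `ḡ ∈ G₁(F)`, `s_{−a}(ḡ) ∈ i_{−a}(Sp_F)`, and `R_a` carries `i_{−a}` into `i_a`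
    have hγ0 : γ ∈ (rationalPairToAdelic F E c N 1 JV (JW F E a)).range := hγ
    have h2 : s (-a) (pairConjNeg F E c N JV hJV a γ) ∈
        (ratSection F (adelicGram F e TV (TW F (-a))) (isUnit_det_adelicGram F e hVd (isUnit_det_TW F (-a)))).range :=
      (hs (-a)).2 _ (pairConjNeg_mem_range_rational F E c N JV hJV a hγ0)
    change relabelNeg F e TV a (s (-a) (pairConjNeg F E c N JV hJV a γ)) ∈
      (ratSection F (adelicGram F e TV (TW F a)) (isUnit_det_adelicGram F e hVd (isUnit_det_TW F a))).range
    exact relabelNeg_mem_range_ratSection F e hVd a _ h2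

end Compatible

end Summit.HodgeConjecture.CorCM.HComp.OmegaConj

end
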